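import Literature.AlgebraicGeometry.CossartJannsenSaito2020.NearPointProjDirectrix
import Literature.AlgebraicGeometry.CossartJannsenSaito2020.KeyTheoremsAPI
import Literature.AlgebraicGeometry.Resolution.BlowupChartMembership
import Literature.AlgebraicGeometry.Resolution.BlowupChartQuasiRegular
import Literature.AlgebraicGeometry.Resolution.PermissibleCentres
import Literature.AlgebraicGeometry.Resolution.MarkedIdealsEtale
import Literature.RingTheory.HilbertSamuel.ProjDirectrixLiftsTransport
import Literature.RingTheory.HilbertSamuel.ProjDirectrixLine
import HarnessLib

/-!
# CJS LNM 2270, Def. 6.34 (i) / p. 103 at `e_x(X) = 1`: `ℙ(Dir_x(X)) ≅ ℙ^0_{k(x)}` is ONE `k(x)`-rational point — PROOF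
# of the named fact `ProjDir_line` (`NearPointProjDirectrix.lean`)

Source: V. Cossart, U. Jannsen, S. Saito, *Desingularization: Invariants and Strategy*, LNM **2270** (2020)
[`CossartJannsenSaito2020`], Def. 6.34 (i) (p. 104) «`X_1 = Bℓ_x(X)` and `C_1 = ℙ(Dir^O_x(X)) ≅ ℙ^{t−1}_{k(x)}`
(`t = e^O_x(X)`)», p. 103 L16 «`C_1 ≃ ℙ^{t−1}_k`», L32 «if `e^O_x(X) ≤ 1` then `k(y) = k(x)`»; typed (statement only,
p503241) as `Literature.AlgebraicGeometry.CossartJannsenSaito2020.ProjDir_line`: for a blow-up `π : X' → X` of a locally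
noetherian scheme in a closed point `x` with `e_x(X) = 1`, the point set `projDirectrixFibre π x` of `ℙ(Dir_x(X)) ⊂ π⁻¹(x)`
is a subsingleton, and at its points `k(x) → k(x')` is an isomorphism. This file PROVES it (`projDir_line`), fact-free,
from the tree's blow-up charts and the ring-level core `Literature/RingTheory/HilbertSamuel/ProjDirectrixLine.lean`:

1. Choose an affine open `U ∋ x`; then `𝓘_{{x}}(U) = 𝔭_x` (`vanishingIdeal_singleton_ideal`), `𝒪_{X,x} = Γ(U)_{𝔭_x}`
   (Mathlib `IsAffineOpen.isLocalization_stalk`) and `𝓘_{{x},x} = 𝔪_x` (`stalkIdeal_vanishingIdeal_singleton`). Fix generators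
   `c_1, …, c_r` of `𝔭_x`; their germs generate `𝔪_x`, so (`exists_linForm_notMem_directrixSpace`, `e_x = 1`) some `c_j`
   has its linear symbol off the directrix hyperplane `𝒯 ⊂ 𝔪_x/𝔪_x²`.
2. At a point `ξ ∈ ℙ(Dir_x(X))` the exceptional ideal `𝔪_x 𝒪_{X',ξ}` is generated by `c_j`
   (`map_maximalIdeal_eq_span_of_projDirLiftsInto`, after transporting `IsOnProjDirectrix` to `𝒪_{X,x}` along
   `stalkCongr`), so `ξ` lies on the ONE chart `g_j : Spec Γ(U)[𝔭_x/c_j] → X'` (`IsBlowup.exists_charts`,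
   `IsBlowup.mem_range_chart_of_stalkIdeal_eq_span`, read for the ideal `span(c)` so that the chart ring is `chartRing c j`).
3. On that chart the ratios `c_k/c_j` take prescribed `k(x)`-rational values at `ξ` (`exists_forall_sub_mul_mem_of_
   projDirLiftsInto`, read through the stalk isomorphism of `g_j` and the localisation `D → 𝒪_{Spec D, w}`; this chart
   algebra is the private lemma `asIdeal_eq_and_isIso_of_chart`, stated for an abstract chart ring `D` generated by the
   `e_k = c_k/c_j` with `c_j` a nonzerodivisor): the prime `w` of `ξ = g_j(w)` contains the ideal
   `𝔑 = 𝔭_x · D + (ŝ_k e_k − r̂_k)_k`, which is MAXIMAL with `Γ(U) ↠ D/𝔑` (`𝔭_x` is maximal as `x` is closed). Hence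
   `w = 𝔑` for every such `ξ` — the fibre set is a subsingleton — and `k(x) → k(ξ)` is onto, i.e. `π.residueFieldMap ξ` is
   an isomorphism.

Boundary-free, as the statement. NOT a statement of H. Hironaka's manuscript; a PROOF of a typed published statement of
[CJS 2020] for the L-lane of cell res-hironaka ([L W4.2], res-L1-w42-plan-1 RULINGS v3.9-2). AI-written; weaker than
expert review.

## References

* V. Cossart, U. Jannsen, S. Saito, LNM 2270 (2020), Def. 2.18, Lemma 2.27, Def. 6.34 (i) (p. 104), p. 103.
  [CossartJannsenSaito2020]
* The Stacks Project, Tag 0804 (charts of a blowing up). [StacksProject]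
-/

noncomputable section

open CategoryTheory AlgebraicGeometry TopologicalSpace IsLocalRing
open Literature.AlgebraicGeometry.Resolution Literature.RingTheory.HilbertSamuel Literature.RingTheory.MvPolynomial

namespace Literature.AlgebraicGeometry.CossartJannsenSaito2020

universe u

/-! ## Plumbing: one chart of a blow-up, read for an explicit generating family of the centre's ideal -/

/-- The chart `g_j : Spec (R[It])_{(c_j t)} → X'` of a blowing up `π` along `C` over an affine open `U`, for a
generating family `c` of `I = C(U)` (so that the chart ring is literally `chartRing c j`): an open immersion over
`Spec R → X` through `chartBase c j`, containing every point at which `c_j` generates the exceptional ideal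
(`IsBlowup.exists_charts`, `IsBlowup.mem_range_chart_of_stalkIdeal_eq_span`). [cite: StacksProject, Tag 0804] -/
private theorem exists_chart_of_ideal_eq_span {X' X : Scheme.{u}} {π : X' ⟶ X} {C : X.IdealSheafData}
    (hπ : IsBlowup π C) (U : X.affineOpens) {r : ℕ} (c : Fin r → Γ(X, U))
    (hc : C.ideal U = Ideal.span (Set.range c)) (j : Fin r) :
    ∃ g : Spec (.of (chartRing c j)) ⟶ X', IsOpenImmersion g ∧
      g ≫ π = Spec.map (CommRingCat.ofHom (chartBase c j)) ≫ U.2.fromSpec ∧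
      ∀ (x' : X') (hx : π x' ∈ (U : X.Opens)),
        stalkIdeal (C.comap π) x' =
            Ideal.span {(π.stalkMap x').hom ((X.presheaf.germ U (π x') hx).hom (c j))} →
          x' ∈ Set.range g := by
  have key : ∀ (I : Ideal Γ(X, U)) (_ : C.ideal U = I) (b : Γ(X, U)) (hb : b ∈ I),
      ∃ g : Spec (.of (HomogeneousLocalization.Away (reesGrading I) (reesT b hb))) ⟶ X',
        IsOpenImmersion g ∧
        g ≫ π = Spec.map (CommRingCat.ofHom (reesChartBase b hb)) ≫ U.2.fromSpec ∧
        ∀ (x' : X') (hx : π x' ∈ (U : X.Opens)),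
          stalkIdeal (C.comap π) x' =
              Ideal.span {(π.stalkMap x').hom ((X.presheaf.germ U (π x') hx).hom b)} →
            x' ∈ Set.range g := by
    rintro I rfl b hb
    obtain ⟨g, h1, h2, -⟩ := hπ.exists_charts U
    exact ⟨g b hb, h1 b hb, h2 b hb, fun x' hx hgen =>
      hπ.mem_range_chart_of_stalkIdeal_eq_span U hb (g b hb) (h2 b hb) hx hgen⟩
  exact key _ hc (c j) (Ideal.mem_span_range_self (f := c) (x := j))

/-- On a chart `g : Spec D → X'` with `g ≫ π = Spec f ≫ (Spec Γ(X, U) → X)`: `g^♯_w ∘ π^♯_{g w} ∘ germ = (D → 𝒪_{Spec D, w}) ∘ f`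
(germs of `appLE_chart_eq`). [cite: StacksProject, Tag 0804] -/
private theorem stalkMap_stalkMap_germ_of_chart {X' X : Scheme.{u}} (π : X' ⟶ X) (U : X.affineOpens)
    {D : CommRingCat.{u}} (g : Spec D ⟶ X') (f : Γ(X, U) ⟶ D)
    (hg : g ≫ π = Spec.map f ≫ U.2.fromSpec) (w : Spec D) (hx : π (g w) ∈ (U : X.Opens)) (r : Γ(X, U)) :
    (g.stalkMap w).hom ((π.stalkMap (g w)).hom ((X.presheaf.germ U (π (g w)) hx).hom r)) =
      ((Spec D).presheaf.germ ⊤ w trivial).hom ((Scheme.ΓSpecIso D).inv.hom (f.hom r)) := by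
  have e := top_le_preimage_of_chart U g f hg
  have h1 : ((Spec D).presheaf.germ ⊤ w trivial).hom ((g ≫ π).appLE U ⊤ e r) =
      ((g ≫ π).stalkMap w).hom ((X.presheaf.germ U ((g ≫ π) w) (e trivial)).hom r) := by
    change ((g ≫ π).appLE U ⊤ e ≫ (Spec D).presheaf.germ ⊤ w trivial).hom r =
      (X.presheaf.germ U ((g ≫ π) w) (e trivial) ≫ (g ≫ π).stalkMap w).hom r
    rw [Scheme.Hom.germ_stalkMap, Scheme.Hom.appLE, Category.assoc, (Spec D).presheaf.germ_res]
  rw [appLE_chart_eq U g f hg e, Scheme.Hom.stalkMap_comp] at h1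
  exact h1.symm

/-- **`IsOnProjDirectrix` read on `𝒪_{X,x}`** for a point `ξ` with `π ξ = x`: composing `π^♯_ξ` with the identification
`𝒪_{X,x} ≅ 𝒪_{X,π ξ}` of stalks at equal points, the condition becomes `ProjDirLiftsInto` for the fixed minimal
generators of `𝒪_{X,x}` (independence of the minimal system and transport along ring isomorphisms,
`ProjDirectrixLifts(Transport).lean`). [cite: CossartJannsenSaito2020, Def. 2.18, Def. 6.34 (i)] -/
private theorem projDirLiftsInto_of_isOnProjDirectrix {X₁ X : Scheme.{u}} [IsLocallyNoetherian X] (π : X₁ ⟶ X)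
    {x : X} {ξ : X₁} (h : π.base ξ = x) (hP : IsOnProjDirectrix π ξ) :
    ProjDirLiftsInto ((π.stalkMap ξ).hom.comp (X.presheaf.stalkCongr (.of_eq h.symm)).hom.hom)
      (minGenerators (X.presheaf.stalk x)) (span_range_minGenerators _) := by
  set A := X.presheaf.stalk x with hA
  set A' := X.presheaf.stalk (π.base ξ) with hA'
  let αiso : A ≅ A' := X.presheaf.stalkCongr (.of_eq h.symm)
  let α : A ≃+* A' := αiso.commRingCatIsoToRingEquiv
  let β : ↑(X₁.presheaf.stalk ξ) ≃+* ↑(X₁.presheaf.stalk ξ) := RingEquiv.refl _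
  have hcomm : ∀ a, (π.stalkMap ξ).hom (α a) = β (((π.stalkMap ξ).hom.comp αiso.hom.hom) a) := fun _ => rfl
  have he : (maximalIdeal A').spanFinrank = (maximalIdeal A).spanFinrank :=
    spanFinrank_maximalIdeal_eq_of_ringEquiv α
  haveI : IsLocalHom (π.stalkMap ξ).hom := π.toLRSHom.prop ξ
  have hgen : Ideal.span (Set.range (α ∘ minGenerators A)) = maximalIdeal A' :=
    span_range_ringEquiv_comp α (span_range_minGenerators A)
  have hsurj : Function.Surjective (Fin.cast he) := fun i => ⟨Fin.cast he.symm i, by simp⟩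
  have hgen' : Ideal.span (Set.range ((α ∘ minGenerators A) ∘ Fin.cast he)) = maximalIdeal A' := by
    rw [hsurj.range_comp]
    exact hgen
  have h1 : ProjDirLiftsInto (π.stalkMap ξ).hom ((α ∘ minGenerators A) ∘ Fin.cast he) hgen' :=
    (projDirLiftsInto_iff_of_minimal_of_isLocalHom _ (span_range_minGenerators A') hgen' rfl).mp hP
  have h2 : ProjDirLiftsInto (π.stalkMap ξ).hom (α ∘ minGenerators A) hgen :=
    (projDirLiftsInto_comp_cast_iff _ he hgen hgen').mp h1
  exact (projDirLiftsInto_ringEquiv_iff α β hcomm (span_range_minGenerators A)).mp h2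

/-! ## The point of a chart with prescribed rational ratios -/

/-- **A point of a chart `Spec D = Spec R[I/c_j]` at which every ratio `e_k = c_k/c_j` takes a prescribed value
`r_k/s_k ∈ k(𝔭)` is THE `k(𝔭)`-rational point `𝔑 = 𝔭·D + (ŝ_k e_k − r̂_k)_k`, and its residue field is `k(𝔭)`.**
Chart algebra for `projDir_line`, stated for an ABSTRACT chart: `g : Spec D → X'` an open immersion with
`g ≫ π = Spec ψ ≫ (Spec R → X)` (`R = Γ(X, U)`), `D` generated over `R` by elements `e_k` with `ψ(c_k) = ψ(c_j) e_k`,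
`ψ(c_j)` a nonzerodivisor (the chart `chartRing c j`: `reesChartBase_apply_eq_mul_chartGen`,
`reesChartBase_mem_nonZeroDivisors`, `eval₂Hom_chartGen_surjective`); `w` a point of the chart over the maximal ideal
`𝔭 ⊆ R`, `A = R_𝔭` with `φ : A → 𝒪_{X', g w}` extending `π^♯ ∘ germ`, and `β_k = r_k/s_k ∈ A` with
`φ(c_k) − φ(β_k)φ(c_j) ∈ φ(c_j)·𝔪`. Then `w = 𝔑` (such a point is unique on the chart) and every element of
`𝒪_{X', g w}` is congruent to some `φ(a)` modulo the maximal ideal (`k(𝔭) → k(g w)` is onto). Tools: the stalk map of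
`g` is an isomorphism and `𝒪_{Spec D, w} = D_w`. [cite: StacksProject, Tag 0804] -/
private theorem asIdeal_eq_and_isIso_of_chart {X' X : Scheme.{u}} (π : X' ⟶ X) (U : X.affineOpens)
    {D : CommRingCat.{u}} (ψ : Γ(X, U) ⟶ D) (g : Spec D ⟶ X') [IsOpenImmersion g]
    (hgπ : g ≫ π = Spec.map ψ ≫ U.2.fromSpec)
    {r : ℕ} (c : Fin r → Γ(X, U)) (j : Fin r) (e : Fin r → D)
    (hce : ∀ k, ψ.hom (c k) = ψ.hom (c j) * e k) (hcj : ψ.hom (c j) ∈ nonZeroDivisors D)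
    (hgen : Function.Surjective (MvPolynomial.eval₂Hom ψ.hom (fun k : {k : Fin r // k ≠ j} => e k.1)))
    (w : Spec D) (hwU : π (g w) ∈ (U : X.Opens))
    (𝔭 : Ideal Γ(X, U)) [𝔭.IsMaximal] (hw𝔭 : w.asIdeal.comap ψ.hom = 𝔭)
    {A : Type u} [CommRing A] [Algebra Γ(X, U) A] [IsLocalization.AtPrime A 𝔭]
    (φ : A →+* X'.presheaf.stalk (g w))
    (hφgerm : ∀ s : Γ(X, U), φ (algebraMap Γ(X, U) A s) =
      (π.stalkMap (g w)).hom ((X.presheaf.germ U (π (g w)) hwU).hom s))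
    (β : Fin r → A) (rs : Fin r → Γ(X, U) × 𝔭.primeCompl)
    (hβ : ∀ k, φ (algebraMap Γ(X, U) A (c k)) - φ (β k) * φ (algebraMap Γ(X, U) A (c j)) ∈
      Ideal.span {φ (algebraMap Γ(X, U) A (c j))} * maximalIdeal (X'.presheaf.stalk (g w)))
    (hrs : ∀ k, β k * algebraMap Γ(X, U) A (rs k).2 = algebraMap Γ(X, U) A (rs k).1)
    (hφlift : ∀ a₀ : A, ∃ a' : X.presheaf.stalk (π (g w)), (π.stalkMap (g w)).hom a' = φ a₀) :
    w.asIdeal = 𝔭.map ψ.hom ⊔ Ideal.span (Set.range fun k =>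
        ψ.hom ((rs k).2 : Γ(X, U)) * e k - ψ.hom (rs k).1) ∧
      IsIso (π.residueFieldMap (g w)) := by
  classical
  have h𝔭max : 𝔭.IsMaximal := ‹_›
  set 𝔑 : Ideal D := 𝔭.map ψ.hom ⊔ Ideal.span (Set.range fun k =>
    ψ.hom ((rs k).2 : Γ(X, U)) * e k - ψ.hom (rs k).1) with h𝔑
  -- (N2a) `R → D/𝔑` is onto: first the generators `e_k ≡ y_k r_k`
  have hgenk : ∀ k, ∃ ρ : Γ(X, U), e k - ψ.hom ρ ∈ 𝔑 := by
    intro k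
    obtain ⟨y, i, hi, hyi⟩ := h𝔭max.exists_inv (rs k).2.2
    refine ⟨y * (rs k).1, ?_⟩
    have h1 : (ψ.hom y * ψ.hom (rs k).2 + ψ.hom i) * e k = e k := by
      rw [← map_mul, ← map_add, hyi, map_one, one_mul]
    have hdec : e k - ψ.hom (y * (rs k).1) =
        ψ.hom y * (ψ.hom ((rs k).2 : Γ(X, U)) * e k - ψ.hom (rs k).1) + ψ.hom i * e k := by
      rw [map_mul]
      calc e k - ψ.hom y * ψ.hom (rs k).1
          = (ψ.hom y * ψ.hom (rs k).2 + ψ.hom i) * e k - ψ.hom y * ψ.hom (rs k).1 := by rw [h1]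
        _ = ψ.hom y * (ψ.hom ((rs k).2 : Γ(X, U)) * e k - ψ.hom (rs k).1) + ψ.hom i * e k := by ring
    rw [hdec]
    exact 𝔑.add_mem
      (Ideal.mul_mem_left _ _ (Ideal.mem_sup_right (Ideal.subset_span ⟨k, rfl⟩)))
      (Ideal.mul_mem_right _ _ (Ideal.mem_sup_left (Ideal.mem_map_of_mem ψ.hom hi)))
  have hN2a : ∀ d : D, ∃ ρ : Γ(X, U), d - ψ.hom ρ ∈ 𝔑 := by
    suffices h : ∀ P : MvPolynomial {k : Fin r // k ≠ j} Γ(X, U), ∃ ρ : Γ(X, U),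
        MvPolynomial.eval₂Hom ψ.hom (fun k : {k : Fin r // k ≠ j} => e k.1) P - ψ.hom ρ ∈ 𝔑 by
      intro d
      obtain ⟨P, rfl⟩ := hgen d
      exact h P
    intro P
    induction P using MvPolynomial.induction_on with
    | C s =>
      refine ⟨s, ?_⟩
      rw [MvPolynomial.eval₂Hom_C, sub_self]
      exact 𝔑.zero_mem
    | add p q hp hq =>
      obtain ⟨ρ₁, h₁⟩ := hp
      obtain ⟨ρ₂, h₂⟩ := hq
      refine ⟨ρ₁ + ρ₂, ?_⟩
      have : MvPolynomial.eval₂Hom ψ.hom (fun k : {k : Fin r // k ≠ j} => e k.1) (p + q) -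
            ψ.hom (ρ₁ + ρ₂) =
          (MvPolynomial.eval₂Hom ψ.hom (fun k : {k : Fin r // k ≠ j} => e k.1) p - ψ.hom ρ₁) +
            (MvPolynomial.eval₂Hom ψ.hom (fun k : {k : Fin r // k ≠ j} => e k.1) q - ψ.hom ρ₂) := by
        rw [map_add, map_add]
        ring
      rw [this]
      exact 𝔑.add_mem h₁ h₂
    | mul_X p k hp =>
      obtain ⟨ρ₁, h₁⟩ := hp
      obtain ⟨ρk, hk⟩ := hgenk k.1
      refine ⟨ρ₁ * ρk, ?_⟩
      have : MvPolynomial.eval₂Hom ψ.hom (fun k : {k : Fin r // k ≠ j} => e k.1)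
              (p * MvPolynomial.X k) - ψ.hom (ρ₁ * ρk) =
          (MvPolynomial.eval₂Hom ψ.hom (fun k : {k : Fin r // k ≠ j} => e k.1) p - ψ.hom ρ₁) * e k.1 +
            ψ.hom ρ₁ * (e k.1 - ψ.hom ρk) := by
        rw [map_mul, MvPolynomial.eval₂Hom_X', map_mul]
        ring
      rw [this]
      exact 𝔑.add_mem (Ideal.mul_mem_right _ _ h₁) (Ideal.mul_mem_left _ _ hk)
  -- (N2b) `𝔑` is maximal as soon as it is proper
  have hN2b : 𝔑 ≠ ⊤ → 𝔑.IsMaximal := by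
    intro hne
    refine Ideal.isMaximal_iff.mpr ⟨fun h1 => hne ((Ideal.eq_top_iff_one _).mpr h1), fun J d hJ hd hdJ => ?_⟩
    obtain ⟨ρ, hρ⟩ := hN2a d
    have hρJ : ψ.hom ρ ∈ J := by
      have h2 : ψ.hom ρ = d - (d - ψ.hom ρ) := by ring
      rw [h2]
      exact J.sub_mem hdJ (hJ hρ)
    have hρ𝔭 : ρ ∉ 𝔭 := by
      intro h
      apply hd
      have h2 : d = (d - ψ.hom ρ) + ψ.hom ρ := by ring
      rw [h2]
      exact 𝔑.add_mem hρ (Ideal.mem_sup_left (Ideal.mem_map_of_mem ψ.hom h))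
    obtain ⟨y, i, hi, hyi⟩ := h𝔭max.exists_inv hρ𝔭
    have h3 : (1 : D) = ψ.hom y * ψ.hom ρ + ψ.hom i := by rw [← map_mul, ← map_add, hyi, map_one]
    rw [h3]
    exact J.add_mem (J.mul_mem_left _ hρJ) (hJ (Ideal.mem_sup_left (Ideal.mem_map_of_mem ψ.hom hi)))
  -- the local dictionary: `σ : B = 𝒪_{X', g w} ≅ L = 𝒪_{Spec D, w} = D_w`, `τ : D → L`
  let σ : ↑(X'.presheaf.stalk (g w)) ≃+* ↑((Spec D).presheaf.stalk w) :=
    (asIso (g.stalkMap w)).commRingCatIsoToRingEquiv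
  have hσ : ∀ b, σ b = (g.stalkMap w).hom b := fun _ => rfl
  let τ : D ⟶ (Spec D).presheaf.stalk w := (Scheme.ΓSpecIso D).inv ≫ (Spec D).presheaf.germ ⊤ w trivial
  letI : Algebra D ((Spec D).presheaf.stalk w) := τ.hom.toAlgebra
  haveI hlocL : IsLocalization.AtPrime ((Spec D).presheaf.stalk w) w.asIdeal :=
    StructureSheaf.IsLocalization.to_stalk (R := D) w
  have hστ : ∀ s : Γ(X, U), σ (φ (algebraMap Γ(X, U) A s)) = τ.hom (ψ.hom s) := by
    intro s
    rw [hφgerm, hσ]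
    exact stalkMap_stalkMap_germ_of_chart π U g ψ hgπ w hwU s
  have hσm : ∀ b, b ∈ maximalIdeal (X'.presheaf.stalk (g w)) ↔ σ b ∈ maximalIdeal ((Spec D).presheaf.stalk w) := by
    intro b
    rw [mem_maximalIdeal, mem_maximalIdeal, mem_nonunits_iff, mem_nonunits_iff, MulEquiv.isUnit_map σ]
  have hτw : ∀ d : D, d ∈ w.asIdeal ↔ τ.hom d ∈ maximalIdeal ((Spec D).presheaf.stalk w) :=
    fun d => (IsLocalization.AtPrime.to_map_mem_maximal_iff ((Spec D).presheaf.stalk w) w.asIdeal d).symm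
  -- `ψ(c_j)` is a nonzerodivisor of `L`
  have hreg : τ.hom (ψ.hom (c j)) ∈ nonZeroDivisors ((Spec D).presheaf.stalk w) :=
    map_mem_nonZeroDivisors_of_isLocalization w.asIdeal.primeCompl ((Spec D).presheaf.stalk w) hcj
  -- (c) `𝔑 ≤ w`
  have hN1 : 𝔑 ≤ w.asIdeal := by
    refine sup_le ?_ ?_
    · rw [Ideal.map_le_iff_le_comap, hw𝔭]
    · rw [Ideal.span_le]
      rintro _ ⟨k, rfl⟩
      -- `c_k ≡ β_k c_j` at the point, read in `L`
      obtain ⟨m, hm, hmk⟩ := Ideal.mem_span_singleton_mul.mp (hβ k)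
      have h := congrArg σ hmk
      rw [map_mul, map_sub, map_mul, hστ, hστ, hce k, map_mul] at h
      -- `h : τψc_j * σ m = τψc_j * τ e_k - σφβ_k * τψc_j`
      have e1 : (τ.hom (e k) - σ (φ (β k)) - σ m) * τ.hom (ψ.hom (c j)) = 0 := by
        calc _ = (τ.hom (ψ.hom (c j)) * τ.hom (e k) - σ (φ (β k)) * τ.hom (ψ.hom (c j))) -
            τ.hom (ψ.hom (c j)) * σ m := by ring
          _ = 0 := by rw [← h, sub_self]
      have e2 : τ.hom (e k) = σ (φ (β k)) + σ m := by
        have h0 := (mem_nonZeroDivisors_iff_right.mp hreg) _ e1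
        rw [sub_sub, sub_eq_zero] at h0
        exact h0
      -- `β_k s_k = r_k`
      have e3 : σ (φ (β k)) * τ.hom (ψ.hom (rs k).2) = τ.hom (ψ.hom (rs k).1) := by
        rw [← hστ, ← hστ, ← map_mul, ← map_mul, hrs k]
      have e4 : τ.hom (ψ.hom ((rs k).2 : Γ(X, U)) * e k - ψ.hom (rs k).1) = τ.hom (ψ.hom (rs k).2) * σ m := by
        rw [map_sub, map_mul, e2, ← e3]
        ring
      rw [SetLike.mem_coe, hτw, e4]
      exact Ideal.mul_mem_left _ _ ((hσm m).mp hm)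
  -- (d) `w = 𝔑`
  have hwN : w.asIdeal = 𝔑 :=
    ((hN2b (fun h => w.isPrime.ne_top (top_le_iff.mp (h ▸ hN1)))).eq_of_le w.isPrime.ne_top hN1).symm
  -- (e) every `b ∈ 𝒪_{X', g w}` is `≡ φ(ρ/ρ')` modulo the maximal ideal
  have hres : ∀ b : X'.presheaf.stalk (g w), ∃ a : A, b - φ a ∈ maximalIdeal (X'.presheaf.stalk (g w)) := by
    intro b
    obtain ⟨⟨d, s⟩, hds⟩ := IsLocalization.surj w.asIdeal.primeCompl (σ b)
    obtain ⟨ρ, hρ⟩ := hN2a d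
    obtain ⟨ρ', hρ'⟩ := hN2a s
    have hρ'𝔭 : ρ' ∉ 𝔭 := by
      intro h
      apply s.2
      have h2 : (s : D) = (s - ψ.hom ρ') + ψ.hom ρ' := by ring
      have h3 : (s : D) ∈ 𝔑 := by
        rw [h2]
        exact 𝔑.add_mem hρ' (Ideal.mem_sup_left (Ideal.mem_map_of_mem ψ.hom h))
      exact hN1 h3
    have hunit : IsUnit (algebraMap Γ(X, U) A ρ') :=
      IsLocalization.map_units A ⟨ρ', show ρ' ∈ 𝔭.primeCompl from hρ'𝔭⟩
    refine ⟨algebraMap Γ(X, U) A ρ * ↑(hunit.unit⁻¹), ?_⟩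
    -- `b φ(ρ') - φ(ρ) ∈ 𝔪_B`
    have hmem : b * φ (algebraMap Γ(X, U) A ρ') - φ (algebraMap Γ(X, U) A ρ) ∈
        maximalIdeal (X'.presheaf.stalk (g w)) := by
      rw [hσm, map_sub, map_mul, hστ, hστ]
      have hds' : σ b * τ.hom (s : D) = τ.hom d := hds
      have h2 : σ b * τ.hom (ψ.hom ρ') - τ.hom (ψ.hom ρ) = τ.hom (d - ψ.hom ρ) - σ b * τ.hom (s - ψ.hom ρ') := by
        rw [map_sub, map_sub, ← hds']
        ring
      rw [h2]
      exact Ideal.sub_mem _ ((hτw _).mp (hN1 hρ)) (Ideal.mul_mem_left _ _ ((hτw _).mp (hN1 hρ')))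
    have hu : φ (algebraMap Γ(X, U) A ρ') * φ ↑(hunit.unit⁻¹) = 1 := by
      rw [← map_mul, IsUnit.mul_val_inv, map_one]
    have h3 : b - φ (algebraMap Γ(X, U) A ρ * ↑(hunit.unit⁻¹)) =
        (b * φ (algebraMap Γ(X, U) A ρ') - φ (algebraMap Γ(X, U) A ρ)) * φ ↑(hunit.unit⁻¹) := by
      rw [map_mul, sub_mul, mul_assoc, hu, mul_one]
    rw [h3]
    exact Ideal.mul_mem_right _ _ hmem
  refine ⟨hwN, ?_⟩
  -- (f) `k(π(g w)) → k(g w)` is onto, hence an isomorphism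
  have hsurj : Function.Surjective (π.residueFieldMap (g w)).hom := by
    intro q
    obtain ⟨b, hb⟩ : ∃ b, (X'.residue (g w)).hom b = q := Ideal.Quotient.mk_surjective q
    refine (hres b).elim fun a₀ ha₀ => ?_
    refine (hφlift a₀).elim fun a' ha' => ⟨(X.residue (π (g w))).hom a', ?_⟩
    have h1 : (π.residueFieldMap (g w)).hom ((X.residue (π (g w))).hom a') =
        (X'.residue (g w)).hom ((π.stalkMap (g w)).hom a') := by
      change (X.residue (π (g w)) ≫ π.residueFieldMap (g w)).hom a' =
        (π.stalkMap (g w) ≫ X'.residue (g w)).hom a'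
      rw [Scheme.residue_residueFieldMap]
    rw [h1, ← hb, ha']
    change IsLocalRing.residue _ (φ a₀) = IsLocalRing.residue _ b
    rw [← sub_eq_zero, ← map_sub, IsLocalRing.residue_eq_zero_iff, ← Ideal.neg_mem_iff, neg_sub]
    exact ha₀
  have hbij : Function.Bijective (π.residueFieldMap (g w)).hom :=
    ⟨(π.residueFieldMap (g w)).hom.injective, hsurj⟩
  exact (RingEquiv.ofBijective _ hbij).toCommRingCatIso.isIso_hom

/-! ## The theorem -/

set_option maxHeartbeats 800000 in
-- one long proof over large chart types (the Rees chart `chartRing c j` over `Γ(X, U)`)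
/-- **CJS 2020, Def. 6.34 (i) / p. 103 at `t = e_x(X) = 1`, PROVED: `ℙ(Dir_x(X)) ≅ ℙ^0_{k(x)}` is a single
`k(x)`-rational point.** For a blow-up `π : X' ⟶ X` of a locally noetherian scheme `X` in a closed point `x` with
`e_x(X) = 1`, the set `projDirectrixFibre π x` has at most one point, and at such a point `x'` the residue field map
`k(x) → k(x')` is an isomorphism («if `e^O_x(X) ≤ 1` then `k(y) = k(x)`», p. 103 L32). Discharges the named fact
`ProjDir_line` of `NearPointProjDirectrix.lean` (module docstring for the proof). [cite: CossartJannsenSaito2020, Def. 6.34 (i), p. 103] -/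
theorem projDir_line : ProjDir_line.{u} := by
  intro X X' _ π x hx hπ hdir
  classical
  -- (0) the centre `C`, an affine open `U ∋ x`, `𝔭 = 𝔭_x ⊆ R = Γ(X, U)`, `𝒪_{X,x} = R_𝔭`
  obtain ⟨U, hxU⟩ : ∃ U : X.affineOpens, x ∈ (U : X.Opens) := by
    obtain ⟨U₀, hU, hxU, -⟩ :=
      exists_isAffineOpen_mem_and_subset (X := X) (x := x) (U := ⊤) (Opens.mem_top x)
    exact ⟨⟨U₀, hU⟩, hxU⟩
  obtain ⟨𝔭, h𝔭⟩ : ∃ 𝔭 : PrimeSpectrum Γ(X, U), 𝔭 = U.2.primeIdealOf ⟨x, hxU⟩ := ⟨_, rfl⟩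
  haveI h𝔭max : 𝔭.asIdeal.IsMaximal := h𝔭 ▸ U.2.primeIdealOf_isMaximal_of_isClosed ⟨x, hxU⟩ hx
  haveI : IsNoetherianRing Γ(X, U) := IsLocallyNoetherian.component_noetherian U
  letI : Algebra Γ(X, U) (X.presheaf.stalk x) :=
    TopCat.Presheaf.algebra_section_stalk X.presheaf (⟨x, hxU⟩ : (U : X.Opens))
  haveI hloc : IsLocalization.AtPrime (X.presheaf.stalk x) 𝔭.asIdeal :=
    h𝔭 ▸ U.2.isLocalization_stalk ⟨x, hxU⟩
  have halg : ∀ s : Γ(X, U), algebraMap Γ(X, U) (X.presheaf.stalk x) s = (X.presheaf.germ U x hxU).hom s :=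
    fun _ => rfl
  -- `I = C(U) = 𝔭`, generators `c` of `𝔭`
  have hI : (Scheme.IdealSheafData.vanishingIdeal (⟨{x}, hx⟩ : Closeds X)).ideal U = 𝔭.asIdeal := by
    rw [h𝔭]
    exact vanishingIdeal_singleton_ideal U.2 hx hxU
  obtain ⟨r, c, hc⟩ : ∃ (r : ℕ) (c : Fin r → Γ(X, U)), Ideal.span (Set.range c) = 𝔭.asIdeal :=
    Submodule.fg_iff_exists_fin_generating_family.mp (IsNoetherian.noetherian 𝔭.asIdeal)
  have hIc : (Scheme.IdealSheafData.vanishingIdeal (⟨{x}, hx⟩ : Closeds X)).ideal U = Ideal.span (Set.range c) :=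
    hI.trans hc.symm
  -- `e_x(X) = 1` for the fixed minimal generators of `𝔪_x`
  have hd : directrixDim (tangentConeIdeal (minGenerators (X.presheaf.stalk x))
      (span_range_minGenerators (X.presheaf.stalk x))) = 1 := hdir
  -- the germs of the `c_l` lie in `𝔪_x` and generate it; expansions `c_l = Σ_i a_{li} x_i`
  have hcm : ∀ l, algebraMap Γ(X, U) (X.presheaf.stalk x) (c l) ∈ maximalIdeal (X.presheaf.stalk x) :=
    fun l => (IsLocalization.AtPrime.to_map_mem_maximal_iff (X.presheaf.stalk x) 𝔭.asIdeal (c l)).mpr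
      (hc ▸ Ideal.subset_span ⟨l, rfl⟩)
  have hspanA : Ideal.span (Set.range fun l => algebraMap Γ(X, U) (X.presheaf.stalk x) (c l)) =
      maximalIdeal (X.presheaf.stalk x) := by
    have h := IsLocalization.AtPrime.map_eq_maximalIdeal 𝔭.asIdeal (X.presheaf.stalk x)
    rwa [← hc, Ideal.map_span, ← Set.range_comp] at h
  have hexp : ∀ l, ∃ a : Fin (maximalIdeal (X.presheaf.stalk x)).spanFinrank → X.presheaf.stalk x,
      ∑ i, a i * minGenerators (X.presheaf.stalk x) i = algebraMap Γ(X, U) (X.presheaf.stalk x) (c l) :=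
    fun l => Ideal.mem_span_range_iff_exists_fun.mp (by rw [span_range_minGenerators]; exact hcm l)
  choose a ha using hexp
  -- (1) a generator `c_j` whose symbol is off the directrix hyperplane
  obtain ⟨j, hj⟩ := exists_linForm_notMem_directrixSpace (span_range_minGenerators (X.presheaf.stalk x)) rfl
    (Nat.one_pos.trans_eq hd.symm) hspanA a (fun l => (ha l).symm)
  -- (2) the chart at `c_j`
  obtain ⟨g, hgopen, hgπ, hgmem⟩ := exists_chart_of_ideal_eq_span hπ U c hIc j
  haveI := hgopen
  -- (3) the ratios `β_k` (`c_k ≡ β_k c_j` at every point of `ℙ(Dir)`) and fractions `β_k = r_k / s_k`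
  have hβex := fun k => exists_forall_sub_mul_mem_of_projDirLiftsInto.{u, u}
    (span_range_minGenerators (X.presheaf.stalk x)) hd (ha j).symm hj (hcm k)
  choose β hβ using hβex
  have hrsex := fun k => IsLocalization.surj 𝔭.asIdeal.primeCompl (β k)
  choose rs hrs using hrsex
  -- (K0) `π^♯_ξ` read on `𝒪_{X,x}` at a point `ξ` over `x` on `ℙ(Dir)`
  have K0 : ∀ (ξ : X') (hξx : π.base ξ = x), IsOnProjDirectrix π ξ →
      ∃ φ : X.presheaf.stalk x →+* X'.presheaf.stalk ξ,
        (∀ s : Γ(X, U), φ (algebraMap Γ(X, U) (X.presheaf.stalk x) s) =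
            (π.stalkMap ξ).hom ((X.presheaf.germ U (π.base ξ) (hξx ▸ hxU)).hom s)) ∧
        (maximalIdeal (X.presheaf.stalk x)).map φ ≤ maximalIdeal (X'.presheaf.stalk ξ) ∧
        ProjDirLiftsInto φ (minGenerators (X.presheaf.stalk x)) (span_range_minGenerators _) ∧
        ∀ a₀ : X.presheaf.stalk x, ∃ a' : X.presheaf.stalk (π.base ξ), (π.stalkMap ξ).hom a' = φ a₀ := by
    intro ξ hξx hP
    let ι : X.presheaf.stalk x ≅ X.presheaf.stalk (π.base ξ) := X.presheaf.stalkCongr (.of_eq hξx.symm)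
    haveI : IsLocalHom (π.stalkMap ξ).hom := π.toLRSHom.prop ξ
    refine ⟨(π.stalkMap ξ).hom.comp ι.hom.hom, fun s => ?_, ?_,
      projDirLiftsInto_of_isOnProjDirectrix π hξx hP, fun a₀ => ⟨ι.hom.hom a₀, rfl⟩⟩
    · rw [halg, RingHom.comp_apply]
      change (π.stalkMap ξ).hom ((X.presheaf.germ U x hxU ≫ ι.hom).hom s) = _
      rw [TopCat.Presheaf.stalkCongr_hom, TopCat.Presheaf.germ_stalkSpecializes]
    · rw [Ideal.map_le_iff_le_comap]
      intro m hm
      rw [Ideal.mem_comap, RingHom.comp_apply]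
      refine map_nonunit (π.stalkMap ξ).hom _ ?_
      rw [mem_maximalIdeal, mem_nonunits_iff] at hm ⊢
      have h2 : ι.inv.hom (ι.hom.hom m) = m := by
        change (ι.hom ≫ ι.inv).hom m = m
        rw [Iso.hom_inv_id]
        rfl
      exact fun hu => hm (h2 ▸ hu.map ι.inv.hom)
  -- (K1) every point of `ℙ(Dir_x(X))` lies on the chart `g`
  have K1 : ∀ ξ ∈ projDirectrixFibre π x, ∃ w : Spec (.of (chartRing c j)), g w = ξ := by
    intro ξ hξ
    obtain ⟨hξx, hP⟩ := (mem_projDirectrixFibre π x ξ).mp hξ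
    obtain ⟨φ, hφgerm, hφm, hPφ, -⟩ := K0 ξ hξx hP
    have ht := map_maximalIdeal_eq_span_of_projDirLiftsInto (span_range_minGenerators (X.presheaf.stalk x)) hd
      (ha j).symm hj φ hφm hPφ
    refine hgmem ξ (hξx ▸ hxU) ?_
    rw [stalkIdeal_comap_eq_map, ← hφgerm, ← ht, stalkIdeal_eq_map_germ _ U (hξx ▸ hxU), hIc,
      Ideal.map_map, Ideal.map_span, ← hspanA, Ideal.map_span, ← Set.range_comp, ← Set.range_comp]
    refine congrArg Ideal.span (congrArg Set.range (funext fun l => ?_))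
    exact (hφgerm (c l)).symm
  -- (K2) on the chart: the prime is `𝔑`, and `k(x) → k(ξ)` is an isomorphism
  have K2 : ∀ (w : Spec (.of (chartRing c j))) (hwx : π.base (g w) = x), IsOnProjDirectrix π (g w) →
      w.asIdeal = 𝔭.asIdeal.map (CommRingCat.ofHom (chartBase c j)).hom ⊔ Ideal.span (Set.range fun k =>
          (CommRingCat.ofHom (chartBase c j)).hom ((rs k).2 : Γ(X, U)) * chartGen c j k -
            (CommRingCat.ofHom (chartBase c j)).hom (rs k).1) ∧
        IsIso (π.residueFieldMap (g w)) := by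
    intro w hwx hP
    obtain ⟨φ, hφgerm, hφm, hPφ, hφlift⟩ := K0 (g w) hwx hP
    -- `w` lies over `𝔭`
    have hw𝔭 : w.asIdeal.comap (CommRingCat.ofHom (chartBase c j)).hom = 𝔭.asIdeal := by
      have h1 : (g ≫ π) w = x := by
        rw [Scheme.Hom.comp_apply]
        exact hwx
      rw [hgπ, Scheme.Hom.comp_apply, Spec.map_apply] at h1
      have h2 : PrimeSpectrum.comap (CommRingCat.ofHom (chartBase c j)).hom w ∈ U.2.fromSpec ⁻¹' {x} := h1
      rw [fromSpec_preimage_singleton U.2 hxU] at h2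
      exact congrArg PrimeSpectrum.asIdeal ((Set.mem_singleton_iff.mp h2).trans h𝔭.symm)
    have hwU : π.base (g w) ∈ (U : X.Opens) := hwx ▸ hxU
    have hβw := fun k => hβ k (X'.presheaf.stalk (g w)) φ hφm hPφ
    have L1 := asIdeal_eq_and_isIso_of_chart π U (CommRingCat.ofHom (chartBase c j)) g hgπ
      c j (fun k => chartGen c j k) (fun k => reesChartBase_apply_eq_mul_chartGen c j k)
      (reesChartBase_mem_nonZeroDivisors (c j) (Ideal.mem_span_range_self (f := c) (x := j)))
      (eval₂Hom_chartGen_surjective c j) w hwU 𝔭.asIdeal hw𝔭 (A := X.presheaf.stalk x) φ hφgerm β rs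
    exact L1 hβw hrs hφlift
  -- (5) conclusion
  refine ⟨fun ξ₁ hξ₁ ξ₂ hξ₂ => ?_, fun ξ hξ => ?_⟩
  · obtain ⟨w₁, rfl⟩ := K1 ξ₁ hξ₁
    obtain ⟨w₂, rfl⟩ := K1 ξ₂ hξ₂
    obtain ⟨h1x, h1P⟩ := (mem_projDirectrixFibre π x _).mp hξ₁
    obtain ⟨h2x, h2P⟩ := (mem_projDirectrixFibre π x _).mp hξ₂
    rw [PrimeSpectrum.ext ((K2 w₁ h1x h1P).1.trans (K2 w₂ h2x h2P).1.symm)]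
  · obtain ⟨w, rfl⟩ := K1 ξ hξ
    obtain ⟨hwx, hP⟩ := (mem_projDirectrixFibre π x _).mp hξ
    exact (K2 w hwx hP).2

end Literature.AlgebraicGeometry.CossartJannsenSaito2020

end

/-! ## `_holds` aliases (appended 2026-08-28, flt-inv gen 65)

The named fact(s) below are already theorems of THIS file under another name; the alias records the
discharge under the tree's exact naming convention `X_holds` (D-0026 bookkeeping: the proof term is the
existing theorem; no statement, definition or attribute is edited; no new named fact).  The ledger's debt
table listed each as unproved (`ledger fact claim` GRANTED «status unproved», 2026-08-28T08:5xZ). -/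

/-- `ProjDir_line` — the named fact of `NearPointProjDirectrix.lean` (CJS 2020, Def. 6.34 (i) / p. 103 at `t = e_x(X) = 1`: `ℙ(Dir_x(X))` has at most one point and `k(x) → k(x')` is an isomorphism there) holds — PROVED in this file as `projDir_line` (`Literature.AlgebraicGeometry.CossartJannsenSaito2020.projDir_line`). [cite: CossartJannsenSaito2020, Def. 6.34 (i), p. 103] -/
theorem _root_.Literature.AlgebraicGeometry.CossartJannsenSaito2020.ProjDir_line_holds : _root_.Literature.AlgebraicGeometry.CossartJannsenSaito2020.ProjDir_line :=
  _root_.Literature.AlgebraicGeometry.CossartJannsenSaito2020.projDir_line
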